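import Literature.AlgebraicGeometry.HodgeTheory.GoursatKolchinRibetKernels
import Literature.AlgebraicGeometry.HodgeTheory.GlZariskiClosureImage
import HarnessLib

/-!
# Goursat–Kolchin–Ribet: `G°` maps onto each `Gᵢ°` — the projection form (1′) of hypothesis (1) implies its
# lift form, so the primed fact `Katz1990_goursatKolchinRibet_specialLinear'` FOLLOWS from the unprimed one
# (Katz 1990, proof of Prop. 1.8.2, first paragraph; Springer 2.2.5)

Family `hodge`, layer `Literature/AlgebraicGeometry/HodgeTheory`. THEOREMS only. Vocabulary of
`GoursatKolchinRibetCriterion`: `H ≤ Πᵢ GL(Eᵢ)`, `Δ = blockDiagHom(H) ≤ GL(⊕ Eᵢ)`, `G = Δ^Zar`,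
`G° = glIdentityComponent Δ`, `ρᵢ = Pi.evalMonoidHom _ i`. The two renderings of Katz's hypothesis (1)
differ in where `SL(Eᵢ)` is placed: the unprimed fact asks for the LIFT form «every `u ∈ SL(Eᵢ)` is the
`i`-th block of an element of `G°`», the primed fact for the projection form (1′)
«`SL(Eᵢ) ⊆ ((ρᵢ H)^Zar)°`». Katz (p. 31 L14): "By definition, `G` maps onto each `Gᵢ := ρᵢ(G)`.
Therefore `G°` maps onto each `Gᵢ°`" — the closed-image theorem [cite: SpringerLAG1998, 2.2.5]. This file
PROVES that step on `ℂ`-points and concludes `Katz1990_goursatKolchinRibet_specialLinear →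
Katz1990_goursatKolchinRibet_specialLinear'` (so the tree's two Katz facts are one debt).

* §1 `exists_eq_blockDiagHom_of_mem_glZariskiClosure` — the closure of a block-diagonal group is block
  diagonal: every `g ∈ Δ^Zar` is `blockDiagHom s` (off-diagonal matrix entries are coordinate polynomials
  vanishing on `Δ`).
* §2 `exists_blockDiagHom_mem_glIdentityComponent_of_mem` — **`((ρᵢ H)^Zar)° ⊆ ρᵢ(G°)`**: the block
  projection `G = Δ^Zar → GL(Eᵢ)` is a polynomial homomorphism whose image of `Δ` is `ρᵢ H`, so
  `GlZariskiClosureImage.exists_eq_of_mem_glIdentityComponent_map` (Springer 2.2.5 (iv)) applies.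
* §3 `Katz1990_goursatKolchinRibet_specialLinear'_of_specialLinear` — the primed fact from the unprimed one;
  and with `GoursatKolchinRibetKernels`: under (1′) every block kernel `Kᵢ` contains `G° ∩ ιᵢ(GL(Eᵢ))`, etc.
Written by the prover seat `hodge-nonav-prover-Ax` (cell `hodge-nonav`) for crux K1 of
`Summits/HodgeConjecture/HodgeConjecture/Theses/CyclicUnitaryPowers.lean`.

## References
* [Katz1990ESDE] N. M. Katz, *Exponential Sums and Differential Equations* (1990), §1.8 Prop. 1.8.2 and its
  proof, first paragraph.
* [SpringerLAG1998] T. A. Springer, *Linear Algebraic Groups*, 2nd ed. (1998), 2.2.5 (ii), (iv).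
* [Borel1991] A. Borel, *Linear Algebraic Groups*, 2nd ed. (1991), I.2.1.
-/

noncomputable section

open Module Literature.AlgebraicGeometry.Motives

namespace Literature.AlgebraicGeometry.HodgeTheory

universe u v

variable {ι : Type u} [Fintype ι] [DecidableEq ι] {E : ι → Type v} [∀ i, AddCommGroup (E i)]
  [∀ i, Module ℂ (E i)] [∀ i, FiniteDimensional ℂ (E i)]

/-! ### §1 The closure of a block-diagonal group is block diagonal -/

omit [Fintype ι] [∀ i, FiniteDimensional ℂ (E i)] in
/-- An automorphism of `⊕ⱼ Eⱼ` all of whose off-diagonal blocks vanish maps vectors supported at `j` to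
vectors supported at `j`. [cite: Katz1990ESDE, §1.8 Prop. 1.8.2] -/
private theorem apply_single_eq_single_of_offDiag {g : (Π j, E j) ≃ₗ[ℂ] (Π j, E j)}
    (hg : ∀ j j', j ≠ j' → ∀ x : E j', (g (Pi.single j' x)) j = 0) (j : ι) (x : E j) :
    g (Pi.single j x) = Pi.single j ((g (Pi.single j x)) j) := by
  funext j'
  by_cases h : j' = j
  · subst h; rw [Pi.single_eq_same]
  · rw [Pi.single_eq_of_ne h, hg j' j h]

/-- **The Zariski closure of a block-diagonal group is block diagonal**: for `H ≤ Πⱼ GL(Eⱼ)`, every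
`g ∈ (blockDiagHom H)^Zar(ℂ)` is `blockDiagHom s` for some family `s` — the off-diagonal matrix entries, in the
product basis, are coordinate polynomials vanishing on `blockDiagHom H`, hence on its closure.
[cite: Katz1990ESDE, §1.8 Prop. 1.8.2] [cite: Borel1991, I.2.1] -/
theorem exists_eq_blockDiagHom_of_mem_glZariskiClosure (H : Subgroup (Π j, (E j ≃ₗ[ℂ] E j)))
    {g : (Π j, E j) ≃ₗ[ℂ] (Π j, E j)} (hg : g ∈ glZariskiClosure (H.map (blockDiagHom E))) :
    ∃ s : Π j, (E j ≃ₗ[ℂ] E j), blockDiagHom E s = g := by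
  classical
  let b : ∀ j, Module.Basis (Fin (finrank ℂ (E j))) ℂ (E j) := fun j => Module.finBasis ℂ (E j)
  let B := Pi.basis b
  -- off-diagonal blocks of every element of the closure vanish
  have hoff : ∀ {x : (Π j, E j) ≃ₗ[ℂ] (Π j, E j)}, x ∈ glZariskiClosure (H.map (blockDiagHom E)) →
      ∀ j j', j ≠ j' → ∀ y : E j', (x (Pi.single j' y)) j = 0 := by
    intro x hx j j' hjj'
    -- the linear map `y ↦ (x (single j' y)) j` vanishes on the basis `b j'`
    suffices hb : ∀ k', (x (Pi.single j' (b j' k'))) j = 0 by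
      intro y
      have hlin : ((LinearMap.proj j).comp ((x : (Π j, E j) →ₗ[ℂ] (Π j, E j)).comp (LinearMap.single ℂ E j')) : E j' →ₗ[ℂ] E j) = 0 :=
        (b j').ext fun k' => by simpa using hb k'
      simpa using LinearMap.congr_fun hlin y
    intro k'
    rw [mem_glZariskiClosure_iff, ← zariskiClosureEnd_basis_indep B] at hx
    refine (b j).ext_elem fun k => ?_
    rw [map_zero, Finsupp.zero_apply]
    have hentry : ∀ z : (Π j, E j) ≃ₗ[ℂ] (Π j, E j),
        LinearMap.toMatrix B B (z : Module.End ℂ (Π j, E j)) ⟨j, k⟩ ⟨j', k'⟩ = (b j).repr ((z (Pi.single j' (b j' k'))) j) k := by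
      intro z
      rw [LinearMap.toMatrix_apply, Pi.basis_apply, Pi.basis_repr, LinearEquiv.coe_coe]
    rw [← hentry]
    have h := hx (MvPolynomial.X (⟨j, k⟩, ⟨j', k'⟩)) (by
      rintro _ ⟨_, ⟨h, _, rfl⟩, rfl⟩
      rw [MvPolynomial.eval_X, toMatrix_blockDiagHom, Matrix.blockDiagonal'_apply_ne _ _ _ hjj'])
    rwa [MvPolynomial.eval_X] at h
  have hg' : g⁻¹ ∈ glZariskiClosure (H.map (blockDiagHom E)) := inv_mem_glZariskiClosure hg
  refine ⟨fun j =>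
    { toFun := fun x => (g (Pi.single j x)) j
      map_add' := fun x y => by rw [Pi.single_add, map_add, Pi.add_apply]
      map_smul' := fun c x => by rw [Pi.single_smul, map_smul, Pi.smul_apply, RingHom.id_apply]
      invFun := fun x => (g⁻¹ (Pi.single j x)) j
      left_inv := fun x => by
        change (g⁻¹ (Pi.single j ((g (Pi.single j x)) j))) j = x
        rw [← apply_single_eq_single_of_offDiag (hoff hg), LinearEquiv.coe_inv, LinearEquiv.symm_apply_apply,
          Pi.single_eq_same]
      right_inv := fun x => by
        change (g (Pi.single j ((g⁻¹ (Pi.single j x)) j))) j = x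
        rw [← apply_single_eq_single_of_offDiag (hoff hg'), LinearEquiv.coe_inv, LinearEquiv.apply_symm_apply,
          Pi.single_eq_same] }, ?_⟩
  refine LinearEquiv.ext fun v => funext fun j => ?_
  rw [blockDiagHom_apply]
  change (g (Pi.single j (v j))) j = (g v) j
  conv_rhs => rw [← Finset.univ_sum_single v, map_sum, Finset.sum_apply]
  rw [Finset.sum_eq_single j (fun j' _ hj' => hoff hg j j' (Ne.symm hj') (v j')) (fun h => absurd (Finset.mem_univ j) h)]

/-! ### §2 `G°` maps onto each `Gᵢ°` -/

/-- **`((ρᵢ H)^Zar)°(ℂ) ⊆ ρᵢ(G°)`** (Katz: "`G°` maps onto each `Gᵢ°`"; Springer 2.2.5 (iv)): for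
`H ≤ Πⱼ GL(Eⱼ)` and `u ∈ glIdentityComponent (H.map ρᵢ)`, there is a block-diagonal family `s` with
`blockDiagHom s ∈ glIdentityComponent (H.map blockDiagHom)` and `sᵢ = u`.  The block projection
`Δ^Zar → GL(Eᵢ)` (well defined by §1) is a homomorphism with a polynomial matrix (the `(i,i)` block of the
generic matrix) carrying `Δ` onto `ρᵢ H`; apply `GlZariskiClosureImage.exists_eq_of_mem_glIdentityComponent_map`.
[cite: Katz1990ESDE, §1.8 Prop. 1.8.2 (proof)] [cite: SpringerLAG1998, 2.2.5 (iv)] -/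
theorem exists_blockDiagHom_mem_glIdentityComponent_of_mem (H : Subgroup (Π j, (E j ≃ₗ[ℂ] E j))) (i : ι)
    {u : E i ≃ₗ[ℂ] E i} (hu : u ∈ glIdentityComponent (H.map (Pi.evalMonoidHom (fun j => E j ≃ₗ[ℂ] E j) i))) :
    ∃ s : Π j, (E j ≃ₗ[ℂ] E j), blockDiagHom E s ∈ glIdentityComponent (H.map (blockDiagHom E)) ∧ s i = u := by
  classical
  let b : ∀ j, Module.Basis (Fin (finrank ℂ (E j))) ℂ (E j) := fun j => Module.finBasis ℂ (E j)
  let B := Pi.basis b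
  set Δ : Subgroup ((Π j, E j) ≃ₗ[ℂ] (Π j, E j)) := H.map (blockDiagHom E) with hΔ
  -- the block family `σ g` of an element of the closure, and the block projection `φ`
  have hex : ∀ g : glZariskiClosureSubgroup Δ, ∃ s : Π j, (E j ≃ₗ[ℂ] E j), blockDiagHom E s = g := fun g =>
    exists_eq_blockDiagHom_of_mem_glZariskiClosure H g.2
  choose σ hσ using hex
  have hσ_blockDiag : ∀ (h : Π j, (E j ≃ₗ[ℂ] E j)) (hh : blockDiagHom E h ∈ glZariskiClosureSubgroup Δ),
      σ ⟨blockDiagHom E h, hh⟩ = h := fun h hh => blockDiagHom_injective E (hσ ⟨blockDiagHom E h, hh⟩)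
  let σh : glZariskiClosureSubgroup Δ →* (Π j, (E j ≃ₗ[ℂ] E j)) :=
    { toFun := σ
      map_one' := blockDiagHom_injective E (by rw [hσ, map_one]; rfl)
      map_mul' := fun x y => blockDiagHom_injective E (by rw [map_mul, hσ, hσ, hσ]; rfl) }
  let φ : glZariskiClosureSubgroup Δ →* (E i ≃ₗ[ℂ] E i) := (Pi.evalMonoidHom (fun j => E j ≃ₗ[ℂ] E j) i).comp σh
  have hφ_apply : ∀ g : glZariskiClosureSubgroup Δ, φ g = σ g i := fun g => rfl
  -- its matrix: the `(i,i)` block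
  have hφ : ∀ g : glZariskiClosureSubgroup Δ,
      LinearMap.toMatrix (b i) (b i) ((φ g : E i ≃ₗ[ℂ] E i) : E i →ₗ[ℂ] E i) =
        (evalAtInvDet (LinearMap.toMatrix B B ((g : (Π j, E j) ≃ₗ[ℂ] (Π j, E j)) : Module.End ℂ (Π j, E j)))).mapMatrix
          (Matrix.of fun k l : Fin (finrank ℂ (E i)) =>
            (Polynomial.C (MvPolynomial.X ((⟨i, k⟩ : Σ j, Fin (finrank ℂ (E j))), (⟨i, l⟩ : Σ j, Fin (finrank ℂ (E j))))) :
              Polynomial (MvPolynomial ((Σ j, Fin (finrank ℂ (E j))) × (Σ j, Fin (finrank ℂ (E j)))) ℂ))) := by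
    intro g
    ext k l
    rw [RingHom.mapMatrix_apply, Matrix.map_apply, Matrix.of_apply, evalAtInvDet_C, MvPolynomial.eval_X, hφ_apply]
    conv_rhs => rw [← hσ g, toMatrix_blockDiagHom, Matrix.blockDiagonal'_apply_eq]
  -- the image of `Δ` under `φ` is `ρᵢ H`
  have himage : (Δ.subgroupOf (glZariskiClosureSubgroup Δ)).map φ = H.map (Pi.evalMonoidHom (fun j => E j ≃ₗ[ℂ] E j) i) := by
    ext v
    constructor
    · rintro ⟨g, hg, rfl⟩
      obtain ⟨h, hh, hhg⟩ := Subgroup.mem_map.1 (Subgroup.mem_subgroupOf.1 hg)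
      refine ⟨h, hh, ?_⟩
      rw [Pi.evalMonoidHom_apply, hφ_apply]
      have : σ g = h := blockDiagHom_injective E (by rw [hσ, hhg])
      rw [this]
    · rintro ⟨h, hh, rfl⟩
      have hmem : blockDiagHom E h ∈ glZariskiClosureSubgroup Δ :=
        le_glZariskiClosureSubgroup Δ (Subgroup.mem_map_of_mem _ hh)
      refine ⟨⟨blockDiagHom E h, hmem⟩, Subgroup.mem_subgroupOf.2 (Subgroup.mem_map_of_mem _ hh), ?_⟩
      rw [hφ_apply, hσ_blockDiag h hmem, Pi.evalMonoidHom_apply]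
  rw [← himage] at hu
  obtain ⟨g, hg0, hgu⟩ := exists_eq_of_mem_glIdentityComponent_map B (b i) Δ φ _ hφ hu
  refine ⟨σ g, ?_, ?_⟩
  · rw [hσ]; exact hg0
  · rw [← hφ_apply]; exact hgu

/-! ### §3 The primed fact follows from the unprimed fact -/

/-- **`Katz1990_goursatKolchinRibet_specialLinear → Katz1990_goursatKolchinRibet_specialLinear'`**: the
projection form (1′) of hypothesis (1) implies the lift form, because `G°` maps onto each `Gᵢ°`
(`exists_blockDiagHom_mem_glIdentityComponent_of_mem`); hypotheses (3), (4) and the conclusion are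
identical. So the two Katz facts of the tree are a single debt. [cite: Katz1990ESDE, §1.8 Prop. 1.8.2 (proof)]
[cite: SpringerLAG1998, 2.2.5 (iv)] -/
theorem Katz1990_goursatKolchinRibet_specialLinear'_of_specialLinear
    (hK : Katz1990_goursatKolchinRibet_specialLinear) : Katz1990_goursatKolchinRibet_specialLinear' := by
  intro ι _ hι E _ _ _ hE H h1 h3 h4 u hu
  classical
  refine hK ι hι E hE H (fun i v hv => ?_) h3 h4 u hu
  obtain ⟨s, hs, hsi⟩ := exists_blockDiagHom_mem_glIdentityComponent_of_mem H i (h1 i v hv)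
  exact ⟨s, hs, hsi⟩

/-- Under (1′) alone, the `i`-th block of `G°` is all of `((ρᵢ H)^Zar)°`: with `blockKernel_dichotomy` this
says the block kernel `Kᵢ` is scalar only if `G° → ((ρᵢH)^Zar)°` has (at most) finite, scalar fibres over
`SL(Eᵢ)` — the configuration Katz's Goursat step excludes under (3), (4).  Recorded in the consumable form:
every `u ∈ SL(Eᵢ)` is the `i`-th block of an element of `G°`. [cite: Katz1990ESDE, §1.8 Prop. 1.8.2 (proof)] -/
theorem exists_blockDiagHom_mem_glIdentityComponent_of_det_eq_one (H : Subgroup (Π j, (E j ≃ₗ[ℂ] E j))) (i : ι)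
    (h1 : ∀ u : E i ≃ₗ[ℂ] E i, LinearEquiv.det u = 1 →
      u ∈ glIdentityComponent (H.map (Pi.evalMonoidHom (fun j => E j ≃ₗ[ℂ] E j) i)))
    (u : E i ≃ₗ[ℂ] E i) (hu : LinearEquiv.det u = 1) :
    ∃ s : Π j, (E j ≃ₗ[ℂ] E j), blockDiagHom E s ∈ glIdentityComponent (H.map (blockDiagHom E)) ∧ s i = u :=
  exists_blockDiagHom_mem_glIdentityComponent_of_mem H i (h1 u hu)

end Literature.AlgebraicGeometry.HodgeTheory

end
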